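import Summits.ResolutionOfSingularities.ResolutionOfSingularities.Theorems.FrobeniusClosingCampaignW41PowerSeriesDerivations
import HarnessLib

/-!
# Crux `Steer` (stmt-16345), r9 `stub_core4Iso`, seam M′ `exists_coeff_ne_zero_of_partials` (DICT-SIGS)

OURS (campaign `res-hironaka`, rung L, slot W4.1, chain W4.1; replaces the role of no printed item; NOT a
statement of the manuscript under review). Lead-1's DICT-SIGS signature M′, verbatim: an `(X)`-primary
ideal of partial derivatives forces a coefficient OFF the `p`-divisible exponents — otherwise `F` is
supported on `pℕ^d`, every `∂_l F` vanishes in characteristic `p`, and `(X) ^ N = 0` is absurd for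
`0 < d`. No `Theses.*` / `Cruxes.*` import. [folklore]
-/

noncomputable section

-- layout-mandated namespace `Summit.<Summit>.<Problem>.…` with Summit = Problem (single-conjunct summit)
set_option linter.dupNamespace false

open MvPowerSeries
open Literature.AlgebraicGeometry.Resolution

namespace Summit.ResolutionOfSingularities.ResolutionOfSingularities.Theorems.SwitchingDichotomy.MultP

/-- In characteristic `p`, a series supported on the `p`-divisible exponents has all partial derivatives
zero: the coefficient of `X^e` in `∂_l F` is `(e_l + 1) · F_{e + δ_l}`, and either `p ∣ e_l + 1` (the
factor vanishes) or the exponent `e + δ_l` is off the lattice (the coefficient vanishes). [folklore] -/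
theorem pderiv_eq_zero_of_forall_coeff_eq_zero {κ : Type*} [Field κ] (p : ℕ) [Fact p.Prime] [CharP κ p]
    {d : ℕ} (F : MvPowerSeries (Fin d) κ)
    (hF : ∀ A : Fin d →₀ ℕ, (¬ ∀ l, p ∣ A l) → coeff A F = 0) (l : Fin d) :
    MvPowerSeries.pderiv l F = 0 := by
  ext e
  rw [MvPowerSeries.coeff_pderiv, coeff_zero]
  by_cases hdiv : p ∣ e l + 1
  · have h0 : ((e l : κ) + 1) = 0 := by
      have : ((e l + 1 : ℕ) : κ) = 0 := (CharP.cast_eq_zero_iff κ p _).mpr hdiv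
      exact_mod_cast this
    rw [h0, zero_mul]
  · rw [hF _ fun h => hdiv ?_, mul_zero]
    have := h l
    rwa [Finsupp.add_apply, Finsupp.single_eq_same] at this

/-- **M′ `exists_coeff_ne_zero_of_partials` (DICT-SIGS, verbatim).** If `(X₁, …, X_d) ^ N` lies in the
ideal of partial derivatives `(∂₁ F, …, ∂_d F)` of `F ∈ κ⟦X₁..X_d⟧` (`κ` of characteristic `p`, `0 < d`),
then `F` has a non-zero coefficient at an exponent with some coordinate not divisible by `p`.
[folklore] -/
theorem exists_coeff_ne_zero_of_partials {κ : Type} [Field κ] (p : ℕ) [Fact p.Prime] [CharP κ p]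
    (d : ℕ) (hd : 0 < d) (F : MvPowerSeries (Fin d) κ) (N : ℕ)
    (hN : Ideal.span (Set.range (X : Fin d → MvPowerSeries (Fin d) κ)) ^ N ≤
      Ideal.span (Set.range fun l : Fin d => MvPowerSeries.pderiv l F)) :
    ∃ A : Fin d →₀ ℕ, (¬ ∀ l, p ∣ A l) ∧ coeff A F ≠ 0 := by
  by_contra hne
  push Not at hne
  have hzero : ∀ l : Fin d, MvPowerSeries.pderiv l F = 0 :=
    pderiv_eq_zero_of_forall_coeff_eq_zero p F (fun A hA => hne A (not_forall.mp hA))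
  have hbot : Ideal.span (Set.range fun l : Fin d => MvPowerSeries.pderiv l F) = ⊥ := by
    rw [Ideal.span_eq_bot]
    rintro _ ⟨l, rfl⟩
    exact hzero l
  set i₀ : Fin d := ⟨0, hd⟩ with hi₀
  have hX : (X i₀ : MvPowerSeries (Fin d) κ) ^ N ∈
      Ideal.span (Set.range (X : Fin d → MvPowerSeries (Fin d) κ)) ^ N :=
    Ideal.pow_mem_pow (Ideal.subset_span (Set.mem_range_self i₀)) N
  have h0 : (X i₀ : MvPowerSeries (Fin d) κ) ^ N = 0 := by
    have := hN hX
    rwa [hbot, Ideal.mem_bot] at this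
  have hX0 : (X i₀ : MvPowerSeries (Fin d) κ) ≠ 0 := fun h => by
    have h1 := congrArg (coeff (Finsupp.single i₀ 1)) h
    rw [coeff_X, if_pos rfl, map_zero] at h1
    exact one_ne_zero h1
  exact hX0 (pow_eq_zero_iff'.mp h0).1

end Summit.ResolutionOfSingularities.ResolutionOfSingularities.Theorems.SwitchingDichotomy.MultP

end
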